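import Literature.NumberTheory.Automorphic.PAdicRepsJacquetAdmissibilityProofs
import Literature.NumberTheory.Automorphic.ParabolicInductionSupportProofs
import HarnessLib

/-!
# Jacquet's admissibility theorem for `GL_n(F)`: the discharge

This sibling file of `PAdicReps` discharges the named fact
`Literature.NumberTheory.Automorphic.jacquetAdmissibility_gl F` (**lang.S16**: every irreducible
smooth complex representation of `GL_n(F)`, `F` a non-archimedean local field, is admissible;
Jacquet 1975; Bernstein–Zelevinsky 1976, Theorem 3.25). It is the meeting point of two results
already in the tree:

* `jacquetAdmissibility_gl_of_bernsteinZelevinsky_support` (`PAdicRepsJacquetAdmissibilityProofs`):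
  the reduction of lang.S16 to the supercuspidal support — if every irreducible smooth `π` of every
  `GL_n(F)` embeds into some `i_c σ` with `σ` irreducible smooth supercuspidal on the standard Levi,
  then `π` is admissible (`σ` is admissible by Harish-Chandra, `i_c σ` by Bernstein–Zelevinsky
  1976, 2.25 (c), and admissibility passes to subrepresentations);
* `bernsteinZelevinsky_support_holds` (`ParabolicInductionSupportProofs`): the existence of the
  supercuspidal support (Bernstein–Zelevinsky 1977, Thm. 2.5), proved for all `n` and all spaces
  in the universe of `F`.

Hence `jacquetAdmissibility_gl_holds` below, unconditionally. Theorems only; no `sorry`.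

## References

* I. N. Bernstein, A. V. Zelevinsky, *Representations of the group GL(n, F) where F is a
  non-archimedean local field*, Russian Math. Surveys 31:3 (1976), Theorem 3.25.
  [BernsteinZelevinsky1976]
* I. N. Bernstein, A. V. Zelevinsky, *Induced representations of reductive `p`-adic groups I*,
  Ann. Sci. ÉNS 10 (1977), Thm. 2.5. [BernsteinZelevinsky1977]
* H. Jacquet, *Sur les représentations des groupes réductifs `p`-adiques*, C. R. Acad. Sci. Paris
  280 (1975), 1271–1272. [Jacquet1975]
-/

namespace Literature.NumberTheory.Automorphic

universe u

variable (F : Type u) [Field F] [ValuativeRel F] [TopologicalSpace F] [IsNonarchimedeanLocalField F]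

/-- **Jacquet's admissibility theorem for `GL_n(F)`** (discharge of the named fact
`jacquetAdmissibility_gl`; Jacquet 1975; Bernstein–Zelevinsky 1976, Theorem 3.25): every
irreducible smooth complex representation of `GL_n(F)` on a space in the universe of `F` is
admissible. Proof: the supercuspidal support (`bernsteinZelevinsky_support_holds`) fed into the
reduction `jacquetAdmissibility_gl_of_bernsteinZelevinsky_support`.
[cite: BernsteinZelevinsky1976, Theorem 3.25] -/
theorem jacquetAdmissibility_gl_holds : jacquetAdmissibility_gl F :=
  jacquetAdmissibility_gl_of_bernsteinZelevinsky_support F fun _ _ _ _ =>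
    bernsteinZelevinsky_support_holds F

end Literature.NumberTheory.Automorphic
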